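import Summits.QuantumFields.BalabanUV.Beta.SymBorderGaugeLegContactTwo
import Summits.QuantumFields.BalabanUV.Beta.FP.PeriodisedGaugeLegContacts
import Summits.QuantumFields.BalabanUV.Beta.FP.PeriodisedSymBorderT2IndexWard
import Summits.QuantumFields.BalabanUV.Beta.FP.PeriodisedSymBorderWardContact
import Summits.QuantumFields.BalabanUV.Beta.GAN24.BorderGaugeLegContact

/-!
# `BalabanUV.Beta.FP.PeriodisedSymBorderWardContactTwo` — road «FP», ROUTE T, binder row D1: **THE SECOND-BOND-PERIODISED (0.4) ROW TABLE, PERIODISED,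
# AGAINST THE TORUS GAUGE MODES = FOUR CONTACT TERMS** (torus face of leaf-02's fluctuation-leg law chain G3′σ → G4-B′σ → (P) `SymBorderGaugeLegContactTwo`)

WHAT ([folklore] finite sums BY NAME).  §1 (lattice, generic `d`, `1 ≤ L`): entry ∕ support ∕ summability of an1's row table `symVh₂SAn1` on the `(inr, inl)` block,
Kronecker pairings, and **`tsum_symVh₂SAn1_mul_dz`** — the `dψ`-form of (P)'s packed law `gaugeLeg_symVh₂SAn1_inr_inl` for EVERY `ψ` — plus the same in TABLE letters
**`tsum_symVh₂SAn1_mul_dz_tables`** (the border table `symVhSAt ρ_c` of THIS bond read at the OTHER bond's slot and vice versa; diagonal and far root read `linSym04At ρ_c`;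
dictionary `symVhSAt_inr_inl_eq` = `packVH_inr_inl`, `linSym04At_inr_inl_eq` = `lin04KerAt_eq_symLinKerAt`).  §2 (torus, `ℤ⁴`, `M = Lc·M′`, both bonds torus points):
`borderT2per_law` (the law of `V κ u := Σ'_n symVh₂SAn1 3 Lc κ u κ′ (u′ + M∘n)` against the periodic indicators), bridges `sum_sum_symVhSAt_eq_perZ_dper`,
`sum_linSym04At_eq_perZ` (g17∕(α-1)'s `tsum_linSym04At_translate_eq`), `sum_sum_ite_eq` (two torus bonds share a copy iff EQUAL), and
**`sum_perZ_dper_borderT2per_mul_tgrad`** ∕ **`submatrix_borderT2per_mul_tgrad`** (engine `PeriodisedGaugeLegContacts.sum_perZ_dper_mul_tgrad_of_law` fed g22 B1's family letters):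
`Σ_{y,α} perZ M (dper M (V κ u)) x y (inr μ)(inl α)·tgrad M (y, inl α) s = −( tdelta M (u′+e_{κ′}) s · perZ M (dper M (symVhSAt ρ_c κ u)) x u′ (inr μ)(inl κ′)
+ tdelta M (u+e_κ) s · perZ M (dper M (symVhSAt ρ_c κ′ u′)) x u (inr μ)(inl κ) − tdelta M (u+e_κ) s·[(κ,u)=(κ′,u′)]·c_j·perZ M 𝕄_j x u (inr μ)(inl κ)
+ tdelta M (x+ρ_c+Lc·e_μ) s · (c_j perZ M 𝕄_j x u …)(c_j perZ M 𝕄_j x u′ …) )`.  Consumer: `PeriodisedSymBorderWardContactTwoInstance.torus_c2_sym_weighted` (row `c2` of U21).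
No `def`, no `def … : Prop`, nothing cited, 0 sorry.

HONEST DEPENDENCY (page 1, mandatory): continuum YM on T⁴ ⇐ BetaPertH ∧ nine spine estimates (0/9 proved); BetaPertH ⇐ (D1) ∧ (D4) ∧ CAP+tail;
G-an2-4 gates asym, D1 and NE2/3/4.  HONEST FRAMING (cell contract, verbatim): «discharging `BetaPertH` makes Bałaban's UV stability UNCONDITIONAL —
a real constructive-QFT result; it is NOT the continuum limit and NOT the Clay problem.»  ABSOLUTE RULE (cell charter, verbatim): «No internally-minted
statement may enter as a cited fact. Every hypothesis is either kernel-proved in this package or a verbatim quotation of a PUBLISHED theorem with page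
reference. The manuscript(s) under audit are NOT citable for their own disputed steps — they are the thing under adjudication; programme-internal
(2001/route/tribunal) claims are never citable.»  0 estimates; 0∕4 row-D1 binders (hW, hR, D1Tel, D1Rep); NOT (T-ID), NOT (J-a) complete, NOT SDF, NOT D1,
NOT BetaPertH, NOT continuum, NOT Clay.  D1 formalisation swarm LEAF PROVER 02 (b2b-balaban-beta-d1-formalise-leaf-02 gen 23), 2026-08-23.  No existing file touched.
-/

noncomputable section

open scoped BigOperators

namespace Summit.QuantumFields.BalabanUV.Beta.FP.PeriodisedSymBorderWardContactTwo

open Finset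
open Literature.MathematicalPhysics.QuantumFieldTheory.Balaban1983to89
open Literature.MathematicalPhysics.QuantumFieldTheory.Balaban1983to89.Beta
open ExpKernelCalculus (MKer)
open AffineAveraging (Site box toSite unitVec dz)
open AveragingContours (blk off)
open AveragingContoursRooted (ctr ctrOff ctrOff_mem_box)
open OneStepResolventKernel (Fib)
open Summit.QuantumFields.BalabanUV.Beta.LinearGaugeVH (summable_of_finsupp)
open Summit.QuantumFields.BalabanUV.Beta.SymAveragingHessianCounts (symVhKerAt symLinKerAt)
open Summit.QuantumFields.BalabanUV.Beta.SymAveragingMixedJetTables (symVh2Tab symVh2KerAt symVh₂SAt symVh2Tab_eq_zero₁)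
open Summit.QuantumFields.BalabanUV.Beta.SymSecondOrderTablesAn1 (symVh₂SAn1)
open Summit.QuantumFields.BalabanUV.Beta.SymBorderGaugeLegContactTwo (gaugeLeg_symVh₂SAn1_inr_inl)
open Summit.QuantumFields.BalabanUV.Beta.GAN24.BorderGaugeLegContact (tsum_sum_dz_mul_eq)
open Summit.QuantumFields.BalabanUV.Beta.FP.TorusGaugeCovariance (nearBox mem_nearBox)
open AveragingHessianKernels (Near packVH_inr_inl packVH_inl_inr)
open B4TorusKernel.MultiPeriod (translate translate_apply)
open B6Lemma24Torus (pbox mem_pbox wrap wrap_eq_self wrap_congr)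
open Summit.QuantumFields.BalabanUV.Beta.BorderedHessian (stepScale)
open Summit.QuantumFields.BalabanUV.Beta.DshAn1 (Dsh linSym04At linSym04At_inr_inl)
open Summit.QuantumFields.BalabanUV.Beta.SymAveragingHessianCounts (symVhSAt symVhSAt_translate)
open Summit.QuantumFields.BalabanUV.Beta.SymAveragingWardRootedStencils (lin04KerAt_eq_symLinKerAt)
open Summit.QuantumFields.BalabanUV.Beta.SymShiftedSpread (bhKStepSh)
open Summit.QuantumFields.BalabanUV.Beta.FP.KernelPeriodisationFib (Idx perF perF_apply perZ perZ_apply)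
open Summit.QuantumFields.BalabanUV.Beta.FP.KernelPeriodisationFibLoc (dper)
open Summit.QuantumFields.BalabanUV.Beta.FP.TorusGaugeCovariance (tdelta tdelta_translate tdelta_congr tgrad)
open Summit.QuantumFields.BalabanUV.Beta.FP.PeriodisedBorderTables (dper_apply_of_blockCov)
open Summit.QuantumFields.BalabanUV.Beta.FP.PeriodisedBorderIndexWard (translate_injective)
open Summit.QuantumFields.BalabanUV.Beta.FP.PeriodisedSymBorderIndexWard (symVhSAt_inr_inl_eq_zero_of_not_mem symVhSAt_inr_inl_eq_zero_of_not_mem_family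
  linSym04At_inr_inl_eq_zero_of_not_mem)
open Summit.QuantumFields.BalabanUV.Beta.FP.PeriodisedSymBorderWardContact (tsum_linSym04At_translate_eq)
open Summit.QuantumFields.BalabanUV.Beta.FP.PeriodisedSymBorderT2IndexWard (symVh₂SAn1_inr_inl_eq_zero_of_not_mem_snd summable_symVh₂SAn1_translate_inr_inl
  borderT2per_periodCov borderT2per_inr_inl_eq_zero_of_not_mem_T borderT2per_inr_inl_eq_zero_of_not_mem_S dper_symVhSAt_inr_inl_eq_zero_of_not_mem)
open Summit.QuantumFields.BalabanUV.Beta.FP.PeriodisedGaugeLegContacts (sum_perZ_dper_mul_tgrad_of_law)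

variable {d : ℕ}

/-! ## §1 Support in the fluctuation slot and the `dψ`-form of the row table's fluctuation-leg law -/

section Lattice

variable {L : ℕ} (hL : 1 ≤ L)
include hL

omit hL in
/-- [folklore] The `(inr μ, inl α)` entry of the row table as minus the symmetrised packed kernel (generic `d`; my g22 `symVh₂SAn1_inr_inl` at `d = 3`). -/
theorem symVh₂SAn1_inr_inl_eq (κ : Fin (d + 1)) (u : Site (d + 1)) (κ' : Fin (d + 1)) (u' x z : Site (d + 1)) (μ α : Fin (d + 1)) : symVh₂SAn1 d L κ u κ' u' x z (Sum.inr μ) (Sum.inl α)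
      = -(if off L x = 0 then (1 / 2 : ℝ) * (symVh2KerAt (ctr (d + 1) L) L μ (blk L x) (α, z) (κ, u) (κ', u') + symVh2KerAt (ctr (d + 1) L) L μ (blk L x) (α, z) (κ', u') (κ, u)) else 0) := by
  simp only [symVh₂SAn1, SecondOrderSocketIdentification.atw, Pi.smul_apply, Pi.add_apply, smul_eq_mul, symVh₂SAt, packVH_inl_inr]
  split_ifs <;> ring

omit hL in
/-- [folklore] Fluctuation-slot support of the `(inr, inl)` entries of the row table (generic `d`, `1 ≤ L`): off the support box of the block of `x` they vanish. -/
theorem symVh₂SAn1_inr_inl_eq_zero_of_not_mem (hL : 1 ≤ L) (κ : Fin (d + 1)) (u : Site (d + 1)) (κ' : Fin (d + 1)) (u' x : Site (d + 1))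
    (μ α : Fin (d + 1)) {z : Site (d + 1)} (hz : z ∉ nearBox L (blk L x)) : symVh₂SAn1 d L κ u κ' u' x z (Sum.inr μ) (Sum.inl α) = 0 := by
  rw [mem_nearBox] at hz
  rw [symVh₂SAn1_inr_inl_eq, show ctr (d + 1) L = toSite (ctrOff (d + 1) L) from rfl]
  unfold symVh2KerAt
  rw [symVh2Tab_eq_zero₁ (ctrOff_mem_box hL) μ (blk L x) (f := (α, z)) hz, symVh2Tab_eq_zero₁ (ctrOff_mem_box hL) μ (blk L x) (f := (α, z)) hz]
  simp

omit hL in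
/-- [folklore] Any function times the `(inr, inl)` entry is summable over the fluctuation site (finite support). -/
theorem summable_symVh₂SAn1_mul (hL : 1 ≤ L) (κ : Fin (d + 1)) (u : Site (d + 1)) (κ' : Fin (d + 1)) (u' x : Site (d + 1)) (μ α : Fin (d + 1))
    (g : Site (d + 1) → ℝ) : Summable fun z => g z * symVh₂SAn1 d L κ u κ' u' x z (Sum.inr μ) (Sum.inl α) :=
  summable_of_finsupp (nearBox L (blk L x)) fun z hz => by rw [symVh₂SAn1_inr_inl_eq_zero_of_not_mem hL κ u κ' u' x μ α hz, mul_zero]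

omit hL in
open Classical in
/-- [folklore] Kronecker pairing over the whole lattice against ONE indicator: `Σ'_z ψ z · ([p = z]·c) = ψ p · c`. -/
theorem tsum_mul_ite_mul (ψ : Site (d + 1) → ℝ) (p : Site (d + 1)) (c : ℝ) : ∑' z : Site (d + 1), ψ z * ((if p = z then (1 : ℝ) else 0) * c) = ψ p * c := by
  have h1 : ∀ z : Site (d + 1), ψ z * ((if p = z then (1 : ℝ) else 0) * c) = if z = p then ψ p * c else 0 := by
    intro z
    by_cases hz : z = p
    · subst hz; simp
    · have hz' : ¬ p = z := fun e => hz e.symm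
      simp [hz, hz']
  rw [tsum_congr h1, tsum_ite_eq]

omit hL in
open Classical in
/-- [folklore] Kronecker pairing against the four-term contact combination used below. -/
theorem tsum_mul_lin4 (ψ : Site (d + 1) → ℝ) (p₁ p₂ p₃ : Site (d + 1)) (c₁ c₂ c₃ c₄ : ℝ) : ∑' z : Site (d + 1), ψ z * ((if p₁ = z then (1 : ℝ) else 0) * c₁ + (if p₂ = z then (1 : ℝ) else 0) * c₂
        - (if p₂ = z then (1 : ℝ) else 0) * c₃ + (if p₃ = z then (1 : ℝ) else 0) * c₄) = ψ p₁ * c₁ + ψ p₂ * c₂ - ψ p₂ * c₃ + ψ p₃ * c₄ := by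
  have hs : ∀ (p : Site (d + 1)) (c : ℝ), Summable fun z : Site (d + 1) => ψ z * ((if p = z then (1 : ℝ) else 0) * c) := fun p c =>
    summable_of_finsupp {p} fun z hz => by
      rw [Finset.mem_singleton] at hz
      have hz' : ¬ p = z := fun e => hz e.symm
      simp [hz']
  have e : ∀ z : Site (d + 1), ψ z * ((if p₁ = z then (1 : ℝ) else 0) * c₁ + (if p₂ = z then (1 : ℝ) else 0) * c₂ - (if p₂ = z then (1 : ℝ) else 0) * c₃ + (if p₃ = z then (1 : ℝ) else 0) * c₄)
      = ψ z * ((if p₁ = z then (1 : ℝ) else 0) * c₁) + ψ z * ((if p₂ = z then (1 : ℝ) else 0) * c₂)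
        - ψ z * ((if p₂ = z then (1 : ℝ) else 0) * c₃) + ψ z * ((if p₃ = z then (1 : ℝ) else 0) * c₄) := fun z => by ring
  rw [tsum_congr e, (((hs p₁ c₁).add (hs p₂ c₂)).sub (hs p₂ c₃)).tsum_add (hs p₃ c₄), ((hs p₁ c₁).add (hs p₂ c₂)).tsum_sub (hs p₂ c₃),
    (hs p₁ c₁).tsum_add (hs p₂ c₂), tsum_mul_ite_mul, tsum_mul_ite_mul, tsum_mul_ite_mul, tsum_mul_ite_mul]

omit hL in
open Classical in
/-- [folklore] the diagonal-and-tip indicator of the law splits as the product of the diagonal indicator and the tip indicator. -/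
theorem ite_diag_and_tip_eq_mul (κ κ' : Fin (d + 1)) (u u' z : Site (d + 1)) : (if (κ, u) = (κ', u') ∧ u + unitVec κ = z then (1 : ℝ) else 0)
      = (if (κ, u) = (κ', u') then (1 : ℝ) else 0) * (if u + unitVec κ = z then (1 : ℝ) else 0) := by
  by_cases hP : (κ, u) = (κ', u') <;> by_cases hQ : u + unitVec κ = z <;> simp [hP, hQ]

open Classical in
/-- [folklore] **THE `dψ`-FORM OF THE ROW TABLE's FLUCTUATION-LEG LAW** (centred root, `1 ≤ L`; multiplier leg at `x`, for EVERY `ψ`):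
`Σ'_z Σ_α V₂ κ u κ′ u′ x z (inr μ) (inl α) · (dz ψ)_α(z) = −[off L x = 0]·(ψ(u′ + e_{κ′})·m((κ′,u′),(κ,u)) + ψ(u + e_κ)·m((κ,u),(κ′,u′)) − [(κ,u) = (κ′,u′)]·ψ(u + e_κ)·q(κ,u)
+ ψ(x + ρ_c + L·e_μ)·q(κ,u)·q(κ′,u′))` (`m = symVhKerAt ρ_c L μ (blk L x)`, `q = symLinKerAt ρ_c L μ (blk L x)`). -/
theorem tsum_symVh₂SAn1_mul_dz (κ : Fin (d + 1)) (u : Site (d + 1)) (κ' : Fin (d + 1)) (u' x : Site (d + 1)) (μ : Fin (d + 1)) (ψ : Site (d + 1) → ℝ) :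
    ∑' z, ∑ α, symVh₂SAn1 d L κ u κ' u' x z (Sum.inr μ) (Sum.inl α) * dz ψ α z = -(if off L x = 0 then ψ (u' + unitVec κ') * symVhKerAt (ctr (d + 1) L) L μ (blk L x) (κ', u') (κ, u)
            + ψ (u + unitVec κ) * symVhKerAt (ctr (d + 1) L) L μ (blk L x) (κ, u) (κ', u')
            - ψ (u + unitVec κ) * ((if (κ, u) = (κ', u') then (1 : ℝ) else 0) * symLinKerAt (ctr (d + 1) L) L μ (blk L x) (κ, u)) + ψ (x + ctr (d + 1) L + (L : ℤ) • unitVec μ)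
                * (symLinKerAt (ctr (d + 1) L) L μ (blk L x) (κ, u) * symLinKerAt (ctr (d + 1) L) L μ (blk L x) (κ', u')) else 0) := by
  have h : ∀ z, ∑ α, symVh₂SAn1 d L κ u κ' u' x z (Sum.inr μ) (Sum.inl α) * dz ψ α z
      = ∑ α, dz ψ α z * symVh₂SAn1 d L κ u κ' u' x z (Sum.inr μ) (Sum.inl α) := fun z => Finset.sum_congr rfl fun α _ => mul_comm _ _
  rw [tsum_congr h, tsum_sum_dz_mul_eq (fun α z => symVh₂SAn1 d L κ u κ' u' x z (Sum.inr μ) (Sum.inl α))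
    (fun α g => summable_symVh₂SAn1_mul hL κ u κ' u' x μ α g) ψ]
  simp only [gaugeLeg_symVh₂SAn1_inr_inl hL]
  by_cases hx : off L x = 0
  · simp only [hx, if_true, ite_diag_and_tip_eq_mul κ κ' u u', mul_neg, tsum_neg]
    have e : ∀ z : Site (d + 1), ψ z * ((if u' + unitVec κ' = z then (1 : ℝ) else 0) * symVhKerAt (ctr (d + 1) L) L μ (blk L x) (κ', u') (κ, u)
          + (if u + unitVec κ = z then (1 : ℝ) else 0) * symVhKerAt (ctr (d + 1) L) L μ (blk L x) (κ, u) (κ', u')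
          - (if (κ, u) = (κ', u') then (1 : ℝ) else 0) * (if u + unitVec κ = z then (1 : ℝ) else 0) * symLinKerAt (ctr (d + 1) L) L μ (blk L x) (κ, u)
          + (if x + ctr (d + 1) L + (L : ℤ) • unitVec μ = z then (1 : ℝ) else 0) * (symLinKerAt (ctr (d + 1) L) L μ (blk L x) (κ, u) * symLinKerAt (ctr (d + 1) L) L μ (blk L x) (κ', u')))
        = ψ z * ((if u' + unitVec κ' = z then (1 : ℝ) else 0) * symVhKerAt (ctr (d + 1) L) L μ (blk L x) (κ', u') (κ, u)
          + (if u + unitVec κ = z then (1 : ℝ) else 0) * symVhKerAt (ctr (d + 1) L) L μ (blk L x) (κ, u) (κ', u')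
          - (if u + unitVec κ = z then (1 : ℝ) else 0) * ((if (κ, u) = (κ', u') then (1 : ℝ) else 0) * symLinKerAt (ctr (d + 1) L) L μ (blk L x) (κ, u))
          + (if x + ctr (d + 1) L + (L : ℤ) • unitVec μ = z then (1 : ℝ) else 0)
              * (symLinKerAt (ctr (d + 1) L) L μ (blk L x) (κ, u) * symLinKerAt (ctr (d + 1) L) L μ (blk L x) (κ', u'))) := fun z => by ring
    rw [tsum_congr e, tsum_mul_lin4]
  · simp [hx]

omit hL in
/-- [folklore] dictionary: the `(inr μ, inl α)` entry of the (0.4) border table `symVhSAt ρ` is the packed kernel `m_sym((α,z),(κ,u))` on the root sites. -/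
theorem symVhSAt_inr_inl_eq (ρ : Site (d + 1)) (L : ℕ) (κ : Fin (d + 1)) (u x z : Site (d + 1)) (μ α : Fin (d + 1)) :
    symVhSAt ρ d L rfl κ u x z (Sum.inr μ) (Sum.inl α) = if off L x = 0 then symVhKerAt ρ L μ (blk L x) (α, z) (κ, u) else 0 := by
  simp only [symVhSAt, packVH_inr_inl]

omit hL in
/-- [folklore] dictionary: the `(inr μ, inl α)` entry of the (0.4) first-order kernel of record `linSym04At ρ L` is `q_sym(α,z)` on the root sites. -/
theorem linSym04At_inr_inl_eq (ρ : Site (d + 1)) (L : ℕ) (x z : Site (d + 1)) (μ α : Fin (d + 1)) :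
    linSym04At ρ L x z (Sum.inr μ) (Sum.inl α) = if off L x = 0 then symLinKerAt ρ L μ (blk L x) (α, z) else 0 := by
  rw [linSym04At_inr_inl, lin04KerAt_eq_symLinKerAt]

open Classical in
/-- [folklore] **THE `dψ`-FORM IN TABLE LETTERS**: the same law with the contact kernels named by the (0.4) tables of record — the tip of the OTHER bond reads the
border table of THIS bond at the other bond's slot (`symVhSAt ρ_c κ u x u′ (inr μ) (inl κ′)`), and vice versa; the diagonal and the far-root terms read `linSym04At ρ_c`. -/
theorem tsum_symVh₂SAn1_mul_dz_tables (κ : Fin (d + 1)) (u : Site (d + 1)) (κ' : Fin (d + 1)) (u' x : Site (d + 1)) (μ : Fin (d + 1)) (ψ : Site (d + 1) → ℝ) :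
    ∑' z, ∑ α, symVh₂SAn1 d L κ u κ' u' x z (Sum.inr μ) (Sum.inl α) * dz ψ α z = -(ψ (u' + unitVec κ') * symVhSAt (ctr (d + 1) L) d L rfl κ u x u' (Sum.inr μ) (Sum.inl κ')
          + ψ (u + unitVec κ) * symVhSAt (ctr (d + 1) L) d L rfl κ' u' x u (Sum.inr μ) (Sum.inl κ)
          - ψ (u + unitVec κ) * ((if (κ, u) = (κ', u') then (1 : ℝ) else 0) * linSym04At (ctr (d + 1) L) L x u (Sum.inr μ) (Sum.inl κ)) + ψ (x + ctr (d + 1) L + (L : ℤ) • unitVec μ)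
              * (linSym04At (ctr (d + 1) L) L x u (Sum.inr μ) (Sum.inl κ) * linSym04At (ctr (d + 1) L) L x u' (Sum.inr μ) (Sum.inl κ'))) := by
  rw [tsum_symVh₂SAn1_mul_dz hL, symVhSAt_inr_inl_eq, symVhSAt_inr_inl_eq, linSym04At_inr_inl_eq, linSym04At_inr_inl_eq]
  by_cases hx : off L x = 0
  · simp only [hx, if_true]
  · simp [hx]

end Lattice

/-! ## §2 The torus face (`ℤ⁴`, `M = Lc·M′`): the second-bond-periodised row table, periodised, against the torus gauge-mode columns -/

section Torus

variable {M M' : Fin (3 + 1) → ℕ} [∀ μ, NeZero (M μ)] {Lc : ℕ} [NeZero Lc] (κ' : Fin (3 + 1)) (u' : Site (3 + 1))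
  {V : Fin (3 + 1) → Site (3 + 1) → MKer (3 + 1) (Fib 3)}

omit [∀ μ, NeZero (M μ)] [NeZero Lc] in
/-- [folklore] the periodic indicator reads a shifted copy of a site as the shifted site: `tdelta M (u + M∘n + e) s = tdelta M (u + e) s`. -/
theorem tdelta_translate_add (u n e : Site (3 + 1)) (s : ↥(pbox M)) : tdelta M (translate M u n + e) s = tdelta M (u + e) s :=
  tdelta_congr M (fun i => ⟨n i, by rw [Pi.add_apply, Pi.add_apply, translate_apply]; ring⟩) s

omit [∀ μ, NeZero (M μ)] [NeZero Lc] in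
/-- [folklore] the four table entries of the law vanish when the OTHER bond is outside the window of the multiplier's block. -/
theorem tables_eq_zero_of_snd_not_mem (hLc : 1 ≤ Lc) (κ : Fin (3 + 1)) (u x : Site (3 + 1)) (μ : Fin (3 + 1)) {w : Site (3 + 1)} (hw : w ∉ nearBox Lc (blk Lc x)) (t₁ t₂ t₃ : ℝ) :
    -(t₁ * symVhSAt (ctr (3 + 1) Lc) 3 Lc rfl κ u x w (Sum.inr μ) (Sum.inl κ') + t₂ * symVhSAt (ctr (3 + 1) Lc) 3 Lc rfl κ' w x u (Sum.inr μ) (Sum.inl κ)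
        - t₂ * ((if (κ, u) = (κ', w) then (1 : ℝ) else 0) * linSym04At (ctr (3 + 1) Lc) Lc x u (Sum.inr μ) (Sum.inl κ))
        + t₃ * (linSym04At (ctr (3 + 1) Lc) Lc x u (Sum.inr μ) (Sum.inl κ) * linSym04At (ctr (3 + 1) Lc) Lc x w (Sum.inr μ) (Sum.inl κ'))) = 0 := by
  have hr := ctrOff_mem_box (d := 3 + 1) hLc
  rw [show ctr (3 + 1) Lc = toSite (ctrOff (3 + 1) Lc) from rfl, symVhSAt_inr_inl_eq_zero_of_not_mem hr κ u x μ κ' hw,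
    symVhSAt_inr_inl_eq_zero_of_not_mem_family hr κ' x u μ κ hw, linSym04At_inr_inl_eq_zero_of_not_mem hr x μ κ' hw]
  by_cases h : (κ, u) = (κ', w)
  · obtain ⟨-, rfl⟩ := Prod.mk.inj h
    rw [linSym04At_inr_inl_eq_zero_of_not_mem hr x μ κ hw]; simp
  · simp [h]

omit [∀ μ, NeZero (M μ)] [NeZero Lc] in
/-- [folklore] the four table entries of the law vanish when THIS bond is outside the window of the multiplier's block. -/
theorem tables_eq_zero_of_fst_not_mem (hLc : 1 ≤ Lc) (κ : Fin (3 + 1)) (x w : Site (3 + 1)) (μ : Fin (3 + 1)) {u : Site (3 + 1)} (hu : u ∉ nearBox Lc (blk Lc x)) (t₁ t₂ t₃ : ℝ) :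
    -(t₁ * symVhSAt (ctr (3 + 1) Lc) 3 Lc rfl κ u x w (Sum.inr μ) (Sum.inl κ') + t₂ * symVhSAt (ctr (3 + 1) Lc) 3 Lc rfl κ' w x u (Sum.inr μ) (Sum.inl κ)
        - t₂ * ((if (κ, u) = (κ', w) then (1 : ℝ) else 0) * linSym04At (ctr (3 + 1) Lc) Lc x u (Sum.inr μ) (Sum.inl κ))
        + t₃ * (linSym04At (ctr (3 + 1) Lc) Lc x u (Sum.inr μ) (Sum.inl κ) * linSym04At (ctr (3 + 1) Lc) Lc x w (Sum.inr μ) (Sum.inl κ'))) = 0 := by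
  have hr := ctrOff_mem_box (d := 3 + 1) hLc
  rw [show ctr (3 + 1) Lc = toSite (ctrOff (3 + 1) Lc) from rfl, symVhSAt_inr_inl_eq_zero_of_not_mem_family hr κ x w μ κ' hu,
    symVhSAt_inr_inl_eq_zero_of_not_mem hr κ' w x μ κ hu, linSym04At_inr_inl_eq_zero_of_not_mem hr x μ κ hu]
  simp

open Classical in
/-- [folklore] **THE FLUCTUATION-LEG LAW OF THE SECOND-BOND-PERIODISED ROW TABLE, `dψ`-FORM AGAINST THE PERIODIC INDICATORS** (`hlaw` of the engine
`PeriodisedGaugeLegContacts.sum_perZ_dper_mul_tgrad_of_law`): for `V κ u := Σ'_n symVh₂SAn1 3 Lc κ u κ′ (u′ + M∘n)` and `ψ = tdelta M · s`, the law is the copy sum of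
§1's table-letter law, the other bond's tip read through the period (`tdelta M (u′ + M∘n + e_{κ′}) s = tdelta M (u′ + e_{κ′}) s`). -/
theorem borderT2per_law (hV : V = fun κ u x z a c => ∑' n : Site (3 + 1), symVh₂SAn1 3 Lc κ u κ' (translate M u' n) x z a c)
    (κ : Fin (3 + 1)) (u x : Site (3 + 1)) (μ : Fin (3 + 1)) (s : ↥(pbox M)) : ∑' z, ∑ α, V κ u x z (Sum.inr μ) (Sum.inl α) * dz (fun w => tdelta M w s) α z
      = ∑' n : Site (3 + 1), -(tdelta M (u' + unitVec κ') s * symVhSAt (ctr (3 + 1) Lc) 3 Lc rfl κ u x (translate M u' n) (Sum.inr μ) (Sum.inl κ')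
          + tdelta M (u + unitVec κ) s * symVhSAt (ctr (3 + 1) Lc) 3 Lc rfl κ' (translate M u' n) x u (Sum.inr μ) (Sum.inl κ) - tdelta M (u + unitVec κ) s
              * ((if (κ, u) = (κ', translate M u' n) then (1 : ℝ) else 0) * linSym04At (ctr (3 + 1) Lc) Lc x u (Sum.inr μ) (Sum.inl κ)) + tdelta M (x + ctr (3 + 1) Lc + (Lc : ℤ) • unitVec μ) s
              * (linSym04At (ctr (3 + 1) Lc) Lc x u (Sum.inr μ) (Sum.inl κ) * linSym04At (ctr (3 + 1) Lc) Lc x (translate M u' n) (Sum.inr μ) (Sum.inl κ'))) := by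
  have hLc : 1 ≤ Lc := Nat.one_le_iff_ne_zero.mpr (NeZero.ne Lc)
  subst hV
  -- the copies of the other bond meeting the block of `x` are finitely many
  set Fn : Finset (Site (3 + 1)) := (nearBox Lc (blk Lc x)).preimage (fun n => translate M u' n) (translate_injective (M := M) u').injOn with hFn
  have hFn' : ∀ n ∉ Fn, translate M u' n ∉ nearBox Lc (blk Lc x) := fun n hn h => hn (Finset.mem_preimage.2 h)
  have hVfin : ∀ (z : Site (3 + 1)) (α : Fin (3 + 1)), (∑' n : Site (3 + 1), symVh₂SAn1 3 Lc κ u κ' (translate M u' n) x z (Sum.inr μ) (Sum.inl α))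
      = ∑ n ∈ Fn, symVh₂SAn1 3 Lc κ u κ' (translate M u' n) x z (Sum.inr μ) (Sum.inl α) := fun z α =>
    tsum_eq_sum fun n hn => symVh₂SAn1_inr_inl_eq_zero_of_not_mem_snd κ u κ' x z μ α (hFn' n hn)
  have hsm : ∀ n ∈ Fn, Summable fun z : Site (3 + 1) => ∑ α : Fin (3 + 1), symVh₂SAn1 3 Lc κ u κ' (translate M u' n) x z (Sum.inr μ) (Sum.inl α) * dz (fun w => tdelta M w s) α z := fun n _ =>
    summable_of_ne_finset_zero (s := nearBox Lc (blk Lc x)) fun z hz =>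
      Finset.sum_eq_zero fun α _ => by rw [symVh₂SAn1_inr_inl_eq_zero_of_not_mem hLc κ u κ' _ x μ α hz, zero_mul]
  have hswap : (∑' z : Site (3 + 1), ∑ α : Fin (3 + 1), (∑' n : Site (3 + 1), symVh₂SAn1 3 Lc κ u κ' (translate M u' n) x z (Sum.inr μ) (Sum.inl α)) * dz (fun w => tdelta M w s) α z)
      = ∑ n ∈ Fn, ∑' z : Site (3 + 1), ∑ α : Fin (3 + 1), symVh₂SAn1 3 Lc κ u κ' (translate M u' n) x z (Sum.inr μ) (Sum.inl α) * dz (fun w => tdelta M w s) α z := by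
    rw [← Summable.tsum_finsetSum hsm]
    refine tsum_congr fun z => ?_
    rw [Finset.sum_comm]
    exact Finset.sum_congr rfl fun α _ => by rw [hVfin z α, Finset.sum_mul]
  rw [hswap, Finset.sum_congr rfl fun n _ => tsum_symVh₂SAn1_mul_dz_tables hLc κ u κ' (translate M u' n) x μ (fun w => tdelta M w s)]
  simp only [tdelta_translate_add]
  exact (tsum_eq_sum fun n hn => tables_eq_zero_of_snd_not_mem κ' hLc κ u x μ (hFn' n hn) _ _ _).symm

omit [∀ μ, NeZero (M μ)] in
/-- [folklore] bridge: the double copy sum of the border table of THIS bond read at the other bond's slot IS the torus member `perZ M (dper M (symVhSAt ρ_c κ u))` at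
the other torus bond (finite windows `Fm ⊇` copies of `u`, `Fn ⊇` copies of `u′` meeting the block of `x`). -/
theorem sum_sum_symVhSAt_eq_perZ_dper (hM : ∀ i, M i = Lc * M' i) (hLc : 1 ≤ Lc) (κ : Fin (3 + 1)) (u x : Site (3 + 1)) (μ : Fin (3 + 1))
    {Fm Fn : Finset (Site (3 + 1))} (hFm : ∀ m ∉ Fm, translate M u m ∉ nearBox Lc (blk Lc x)) (hFn : ∀ n ∉ Fn, translate M u' n ∉ nearBox Lc (blk Lc x)) :
    ∑ m ∈ Fm, ∑ n ∈ Fn, symVhSAt (ctr (3 + 1) Lc) 3 Lc rfl κ (translate M u m) x (translate M u' n) (Sum.inr μ) (Sum.inl κ')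
      = perZ M (dper M (symVhSAt (ctr (3 + 1) Lc) 3 Lc rfl κ u)) x u' (Sum.inr μ) (Sum.inl κ') := by
  have hr := ctrOff_mem_box (d := 3 + 1) hLc
  rw [Finset.sum_comm, perZ_apply]
  symm
  rw [tsum_eq_sum (s := Fn) fun n hn => dper_symVhSAt_inr_inl_eq_zero_of_not_mem κ u hM x μ κ' _ (hFn n hn)]
  refine Finset.sum_congr rfl fun n _ => ?_
  rw [show ctr (3 + 1) Lc = toSite (ctrOff (3 + 1) Lc) from rfl,
    dper_apply_of_blockCov hM (fun κ u t => symVhSAt_translate (toSite (ctrOff (3 + 1) Lc)) hLc κ u t)]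
  exact tsum_eq_sum fun m hm => symVhSAt_inr_inl_eq_zero_of_not_mem_family hr κ x _ μ κ' (hFm m hm)

omit [∀ μ, NeZero (M μ)] [NeZero Lc] in
/-- [folklore] bridge: the copy sum of the first-order kernel of record IS `c_j ·` the torus averaging row of the shifted spread (`tsum_linSym04At_translate_eq` on a window). -/
theorem sum_linSym04At_eq_perZ [NeZero Lc] (hLc : 1 ≤ Lc) (j : ℕ) (u x : Site (3 + 1)) (μ κ : Fin (3 + 1)) {Fm : Finset (Site (3 + 1))} (hFm : ∀ m ∉ Fm, translate M u m ∉ nearBox Lc (blk Lc x)) :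
    ∑ m ∈ Fm, linSym04At (ctr (3 + 1) Lc) Lc x (translate M u m) (Sum.inr μ) (Sum.inl κ)
      = ((Lc : ℝ) ^ (3 + 1) * stepScale 3 Lc j)⁻¹ * perZ M (bhKStepSh 3 Lc (Dsh Lc) j) x u (Sum.inr μ) (Sum.inl κ) := by
  have hr := ctrOff_mem_box (d := 3 + 1) hLc
  rw [← tsum_linSym04At_translate_eq (M := M) j x u μ κ]
  exact (tsum_eq_sum fun m hm => by
    rw [show ctr (3 + 1) Lc = toSite (ctrOff (3 + 1) Lc) from rfl]; exact linSym04At_inr_inl_eq_zero_of_not_mem hr x μ κ (hFm m hm)).symm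

omit [∀ μ, NeZero (M μ)] [NeZero Lc] in
/-- [folklore] torus points have themselves as the wrapped representative of each of their copies. -/
theorem wrap_translate_of_mem {u : Site (3 + 1)} (hu : u ∈ pbox M) (m : Site (3 + 1)) : wrap M (translate M u m) = u :=
  (wrap_congr (M := M) fun i => ⟨m i, by rw [translate_apply]; ring⟩).trans (wrap_eq_self hu)

open Classical in
omit [NeZero Lc] in
/-- [folklore] bridge: the diagonal contact — two torus bonds have a common copy iff they are EQUAL, and then copy by copy:
`Σ_{m} Σ_{n} [(κ, u + M∘m) = (κ′, u′ + M∘n)]·f m = [(κ,u) = (κ′,u′)]·Σ_m f m` (`u, u′` torus points; `Fn ⊇ Fm` when `u = u′`). -/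
theorem sum_sum_ite_eq (κ : Fin (3 + 1)) {u : Site (3 + 1)} (hu : u ∈ pbox M) (hu' : u' ∈ pbox M) (f : Site (3 + 1) → ℝ) {Fm Fn : Finset (Site (3 + 1))} (hF : u = u' → Fm ⊆ Fn) :
    ∑ m ∈ Fm, ∑ n ∈ Fn, (if (κ, translate M u m) = (κ', translate M u' n) then (1 : ℝ) else 0) * f m = (if (κ, u) = (κ', u') then (1 : ℝ) else 0) * ∑ m ∈ Fm, f m := by
  by_cases h : (κ, u) = (κ', u')
  · obtain ⟨rfl, rfl⟩ := Prod.mk.inj h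
    rw [if_pos rfl, one_mul]
    refine Finset.sum_congr rfl fun m hm => ?_
    rw [Finset.sum_eq_single_of_mem m (hF rfl hm) fun n _ hnm => by
      rw [if_neg fun e => hnm ((translate_injective (M := M) u) (Prod.mk.inj e).2).symm, zero_mul]]
    rw [if_pos rfl, one_mul]
  · rw [if_neg h, zero_mul]
    refine Finset.sum_eq_zero fun m _ => Finset.sum_eq_zero fun n _ => ?_
    rw [if_neg fun e => h ?_, zero_mul]
    obtain ⟨hκ, e⟩ := Prod.mk.inj e
    have := congrArg (wrap M) e
    rw [wrap_translate_of_mem hu, wrap_translate_of_mem hu'] at this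
    rw [hκ, this]

open Classical in
/-- [folklore] **`sum_perZ_dper_borderT2per_mul_tgrad` — THE SECOND-BOND-PERIODISED ROW TABLE, PERIODISED, AGAINST A TORUS GAUGE-MODE COLUMN** (`M = Lc·M′`;
both bonds torus points): for `V κ u := Σ'_n symVh₂SAn1 3 Lc κ u κ′ (u′ + M∘n)`, the multiplier row `(x, μ)` and any column `s`,
`Σ_y Σ_α perZ M (dper M (V κ u)) x y (inr μ) (inl α) · tgrad M (y, inl α) s =`
`−( tdelta M (u′ + e_{κ′}) s · perZ M (dper M (symVhSAt ρ_c κ u)) x u′ (inr μ) (inl κ′)` (the other bond's tip reads THIS bond's first-order member)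
` + tdelta M (u + e_κ) s · perZ M (dper M (symVhSAt ρ_c κ′ u′)) x u (inr μ) (inl κ)` (this bond's tip reads the OTHER bond's member)
` − tdelta M (u + e_κ) s · [(κ,u) = (κ′,u′)] · c_j · perZ M 𝕄_j x u (inr μ) (inl κ)` (diagonal)
` + tdelta M (x + ρ_c + Lc•e_μ) s · (c_j · perZ M 𝕄_j x u (inr μ) (inl κ)) · (c_j · perZ M 𝕄_j x u′ (inr μ) (inl κ′)) )` (far root; `c_j = (Lc⁴·stepScale 3 Lc j)⁻¹`, any `j`). -/
theorem sum_perZ_dper_borderT2per_mul_tgrad (hM : ∀ i, M i = Lc * M' i)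
    (hV : V = fun κ u x z a c => ∑' n : Site (3 + 1), symVh₂SAn1 3 Lc κ u κ' (translate M u' n) x z a c) (hu' : u' ∈ pbox M) (j : ℕ)
    (κ : Fin (3 + 1)) {u : Site (3 + 1)} (hu : u ∈ pbox M) (x : Site (3 + 1)) (μ : Fin (3 + 1)) (s : ↥(pbox M)) :
    ∑ y : ↥(pbox M), ∑ α : Fin (3 + 1), perZ M (dper M (V κ u)) x (y : Site (3 + 1)) (Sum.inr μ) (Sum.inl α) * tgrad M (y, Sum.inl α) s
      = -(tdelta M (u' + unitVec κ') s * perZ M (dper M (symVhSAt (ctr (3 + 1) Lc) 3 Lc rfl κ u)) x u' (Sum.inr μ) (Sum.inl κ')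
          + tdelta M (u + unitVec κ) s * perZ M (dper M (symVhSAt (ctr (3 + 1) Lc) 3 Lc rfl κ' u')) x u (Sum.inr μ) (Sum.inl κ)
          - tdelta M (u + unitVec κ) s * ((if (κ, u) = (κ', u') then (1 : ℝ) else 0) * (((Lc : ℝ) ^ (3 + 1) * stepScale 3 Lc j)⁻¹ * perZ M (bhKStepSh 3 Lc (Dsh Lc) j) x u (Sum.inr μ) (Sum.inl κ)))
          + tdelta M (x + ctr (3 + 1) Lc + (Lc : ℤ) • unitVec μ) s * ((((Lc : ℝ) ^ (3 + 1) * stepScale 3 Lc j)⁻¹ * perZ M (bhKStepSh 3 Lc (Dsh Lc) j) x u (Sum.inr μ) (Sum.inl κ))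
                * (((Lc : ℝ) ^ (3 + 1) * stepScale 3 Lc j)⁻¹ * perZ M (bhKStepSh 3 Lc (Dsh Lc) j) x u' (Sum.inr μ) (Sum.inl κ')))) := by
  have hLc : 1 ≤ Lc := Nat.one_le_iff_ne_zero.mpr (NeZero.ne Lc)
  rw [sum_perZ_dper_mul_tgrad_of_law V _ (fun x => nearBox Lc (blk Lc x)) (fun x => nearBox Lc (blk Lc x)) (borderT2per_periodCov κ' u' hM hV)
    (fun κ u x μ α => borderT2per_inr_inl_eq_zero_of_not_mem_S κ' u' hV κ u x μ α)
    (fun κ x z μ α => borderT2per_inr_inl_eq_zero_of_not_mem_T κ' u' hV κ x z μ α) (borderT2per_law κ' u' hV) κ u x μ s]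
  -- both copy sums are finite: windows of the block of `x`
  set Fn : Finset (Site (3 + 1)) := (nearBox Lc (blk Lc x)).preimage (fun n => translate M u' n) (translate_injective (M := M) u').injOn with hFn
  have hFn' : ∀ n ∉ Fn, translate M u' n ∉ nearBox Lc (blk Lc x) := fun n hn h => hn (Finset.mem_preimage.2 h)
  set Fm : Finset (Site (3 + 1)) := (nearBox Lc (blk Lc x)).preimage (fun m => translate M u m) (translate_injective (M := M) u).injOn with hFm
  have hFm' : ∀ m ∉ Fm, translate M u m ∉ nearBox Lc (blk Lc x) := fun m hm h => hm (Finset.mem_preimage.2 h)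
  have hsub : u = u' → Fm ⊆ Fn := by rintro rfl; exact subset_of_eq (by rw [hFm, hFn])
  simp only [tdelta_translate_add]
  rw [tsum_eq_sum (s := Fm) fun m hm => (tsum_congr fun n => tables_eq_zero_of_fst_not_mem κ' hLc κ x (translate M u' n) μ (hFm' m hm) _ _ _).trans
    tsum_zero]
  rw [Finset.sum_congr rfl fun m _ => tsum_eq_sum (s := Fn) fun n hn => tables_eq_zero_of_snd_not_mem κ' hLc κ (translate M u m) x μ (hFn' n hn) _ _ _]
  -- finite algebra: split the four terms and name each double window sum
  simp only [Finset.sum_neg_distrib, Finset.sum_add_distrib, Finset.sum_sub_distrib, ← Finset.mul_sum]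
  rw [sum_sum_symVhSAt_eq_perZ_dper κ' u' hM hLc κ u x μ hFm' hFn']
  have hB : ∑ m ∈ Fm, ∑ n ∈ Fn, symVhSAt (ctr (3 + 1) Lc) 3 Lc rfl κ' (translate M u' n) x (translate M u m) (Sum.inr μ) (Sum.inl κ)
      = perZ M (dper M (symVhSAt (ctr (3 + 1) Lc) 3 Lc rfl κ' u')) x u (Sum.inr μ) (Sum.inl κ) := by
    rw [Finset.sum_comm]; exact sum_sum_symVhSAt_eq_perZ_dper κ u hM hLc κ' u' x μ hFn' hFm'
  have hC : ∑ m ∈ Fm, ∑ n ∈ Fn, (if (κ, translate M u m) = (κ', translate M u' n) then (1 : ℝ) else 0) * linSym04At (ctr (3 + 1) Lc) Lc x (translate M u m) (Sum.inr μ) (Sum.inl κ)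
      = (if (κ, u) = (κ', u') then (1 : ℝ) else 0) * (((Lc : ℝ) ^ (3 + 1) * stepScale 3 Lc j)⁻¹ * perZ M (bhKStepSh 3 Lc (Dsh Lc) j) x u (Sum.inr μ) (Sum.inl κ)) := by
    rw [sum_sum_ite_eq κ' u' κ hu hu' _ hsub, sum_linSym04At_eq_perZ hLc j u x μ κ hFm']
  have hD : ∑ m ∈ Fm, linSym04At (ctr (3 + 1) Lc) Lc x (translate M u m) (Sum.inr μ) (Sum.inl κ) * ∑ n ∈ Fn, linSym04At (ctr (3 + 1) Lc) Lc x (translate M u' n) (Sum.inr μ) (Sum.inl κ')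
      = (((Lc : ℝ) ^ (3 + 1) * stepScale 3 Lc j)⁻¹ * perZ M (bhKStepSh 3 Lc (Dsh Lc) j) x u (Sum.inr μ) (Sum.inl κ))
          * (((Lc : ℝ) ^ (3 + 1) * stepScale 3 Lc j)⁻¹ * perZ M (bhKStepSh 3 Lc (Dsh Lc) j) x u' (Sum.inr μ) (Sum.inl κ')) := by
    rw [← Finset.sum_mul, sum_linSym04At_eq_perZ hLc j u x μ κ hFm', sum_linSym04At_eq_perZ hLc j u' x μ κ' hFn']
  rw [hB, hC, hD]

/-- [folklore] **MATRIX FORM AT THE (III′) TORUS CALL's SLOT MAPS** (field slots `(b.1, inl b.2)`; multiplier slots `a ↦ (pμ a, inr (mμ a))`, `pμ a ∈ pbox M`;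
ANY column map `g`): the per-pair entry of `Q₁₂^{b,b′} · D`, `Q₁₂^{b,b′} := (perF M (dper M (V b.2 ↑b.1))).submatrix …` for the bi-family `V` of the second torus
bond `b′ = (u′, κ′)`, in the letters `Q₁₁^{b} Q₁₁^{b′} Q₁₀` of rows `c1`. -/
theorem submatrix_borderT2per_mul_tgrad (hM : ∀ i, M i = Lc * M' i) (hV : V = fun κ u x z a c => ∑' n : Site (3 + 1), symVh₂SAn1 3 Lc κ u κ' (translate M u' n) x z a c) (hu' : u' ∈ pbox M) (j : ℕ)
    {μI γ : Type*} (pμ : μI → Site (3 + 1)) (hpμ : ∀ a, pμ a ∈ pbox M) (mμ : μI → Fin (3 + 1)) (g : γ → ↥(pbox M)) (κ : Fin (3 + 1)) (u : ↥(pbox M)) (a : μI) (c : γ) :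
    ((perF M (dper M (V κ (u : Site (3 + 1))))).submatrix (fun a : μI => ((⟨pμ a, hpμ a⟩, Sum.inr (mμ a)) : Idx M (Fib 3))) (fun b : ↥(pbox M) × Fin (3 + 1) => ((b.1, Sum.inl b.2) : Idx M (Fib 3)))
        * (tgrad M).submatrix (fun b : ↥(pbox M) × Fin (3 + 1) => ((b.1, Sum.inl b.2) : Idx M (Fib 3))) g) a c
      = -(tdelta M (u' + unitVec κ') (g c) * perF M (dper M (symVhSAt (ctr (3 + 1) Lc) 3 Lc rfl κ (u : Site (3 + 1)))) (⟨pμ a, hpμ a⟩, Sum.inr (mμ a)) (⟨u', hu'⟩, Sum.inl κ')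
          + tdelta M ((u : Site (3 + 1)) + unitVec κ) (g c) * perF M (dper M (symVhSAt (ctr (3 + 1) Lc) 3 Lc rfl κ' u')) (⟨pμ a, hpμ a⟩, Sum.inr (mμ a)) (u, Sum.inl κ)
          - tdelta M ((u : Site (3 + 1)) + unitVec κ) (g c) * ((if (κ, (u : Site (3 + 1))) = (κ', u') then (1 : ℝ) else 0)
              * (((Lc : ℝ) ^ (3 + 1) * stepScale 3 Lc j)⁻¹ * perF M (bhKStepSh 3 Lc (Dsh Lc) j) (⟨pμ a, hpμ a⟩, Sum.inr (mμ a)) (u, Sum.inl κ)))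
          + tdelta M (pμ a + ctr (3 + 1) Lc + (Lc : ℤ) • unitVec (mμ a)) (g c)
              * ((((Lc : ℝ) ^ (3 + 1) * stepScale 3 Lc j)⁻¹ * perF M (bhKStepSh 3 Lc (Dsh Lc) j) (⟨pμ a, hpμ a⟩, Sum.inr (mμ a)) (u, Sum.inl κ))
                * (((Lc : ℝ) ^ (3 + 1) * stepScale 3 Lc j)⁻¹ * perF M (bhKStepSh 3 Lc (Dsh Lc) j) (⟨pμ a, hpμ a⟩, Sum.inr (mμ a)) (⟨u', hu'⟩, Sum.inl κ')))) := by
  rw [Matrix.mul_apply, Fintype.sum_prod_type]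
  simp only [Matrix.submatrix_apply, perF_apply]
  exact sum_perZ_dper_borderT2per_mul_tgrad κ' u' hM hV hu' j κ u.2 (pμ a) (mμ a) (g c)

end Torus

end Summit.QuantumFields.BalabanUV.Beta.FP.PeriodisedSymBorderWardContactTwo

end
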